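import Literature.MathematicalPhysics.QuantumFieldTheory.BalabanImbrieJaffe1984to88.BIJ88ProductRuleAllOrders306
import Literature.MathematicalPhysics.QuantumFieldTheory.BalabanImbrieJaffe1984to88.BIJ88CubeProductFDeriv306

/-!
# `BalabanImbrieJaffe1984to88.BIJ88CubeProductDset306` — T. Bałaban, J. Imbrie, A. Jaffe, *Effective action and cluster properties of the
abelian Higgs model*, Commun. Math. Phys. **114** (1988) 257–315 [BalabanImbrieJaffe1988]: pp. 304–306 [PDF 48–50] (Sect. 5.13) — **AT EVERY
ORDER, EACH FIELD DERIVATIVE OF A TRAIN LANDS ON THE CUBE OF ITS SITE**.  Print, p. 305: *"We integrate by parts all fields appearing in this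
formula. Each Φ contracts through a C_s to another Φ, to an f(□_i)_s or to ℱ."*; p. 304: *"f(□_i) is the product of all the factors …
localized in □_i … Our construction of the □_i ensures no overlap of factors between different □_i's"*; p. 306, (5.13.3): the trains
*"⟨δ/δΦ, C_s □_{i₁}Δ□_{i₂} C_s □_{i₃} ⋯⟩"* — a δ/δΦ(x) produced by a train acts on `Π_{□_i⊂X} f(□_i)` and, the factors being CUBE-LOCAL,
only on `f(□_{i(x)})`: this is what makes (5.13.3) a walk THROUGH CUBES.  `BIJ88CubeProductFDeriv306` (p36 g20) proved it at orders 1 and 2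
(`fderiv_obs_single`, `D2_obs`); THIS FILE proves it AT ALL ORDERS in p13's language of iterated directional derivatives
(`BIJ88WickSourceSmooth305.dset`), from the all-orders Leibniz rule `BIJ88ProductRuleAllOrders306.dset_prod_apply`:

  `∂_{q_D}[Π_{□_i⊂X} f(□_i)](φ) = Π_{□_i⊂X} ∂_{q_{D_i}}[f(□_i)](φ)`,   `D_i = {j ∈ D : q_j ∈ □_i}`,

for legs `j ∈ D` along the coordinate directions `e_{q_j}` at sites `q_j` of `X` and cube-local factors `f(□_i) ∈ C_b^∞` — of the
`|X|^{|D|}` assignments of legs to cubes exactly ONE survives locality.  With the located factors `f := fD (uD …)` of Sect. 5.14 (p. 308)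
each cube's factor then splits over its slots by `BIJ88ProductRuleAllOrders306.dset_fD_uD_apply`.

statement-level skeleton of published theorems with citation tags; proofs where landed; nothing here is a claim about the Yang–Mills mass gap

PDF held: `paper:balaban1988-cmp114-bij-abelian-higgs-effective-action` (journal page = PDF page + 256); pages re-read this session as text:
PDF 49 (p. 305) L40–43, PDF 51 (p. 307) L5–18.

CITATION HEADER (lean-in-tree rule).  Part of the lit-balaban TYPED SKELETON (HOME `run/shared/lean/pub/lit-balaban/`), Phase 2, seat p36
(gen 21, unit `lit-balaban-p36`); rows **C2.Eq5.14.3-5.14.4** (member: §f brick 8 — where the train derivatives of the located (5.13.3)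
`BIJ88WalkFormLocated309` land, all orders) and C2.Eq5.13.3-5.13.4 (member: calculus of the cube product the trains act on) of
`HOME/lit-balaban-r16/ROWS-C2-part2.md`.
WHAT IS REPRODUCED (theorem-only; no definitions, no `Prop` facts; axioms standard):
* §1 `dset_zero_fun`, **`dset_eq_zero_of_local`** (a `C_b^∞` factor local to the cube `□_i` has `∂_{u_D} ≡ 0` as soon as one leg's direction
  vanishes on `□_i`; order-independence `IsSmoothClass.dset_insert` + `BIJ88CubeProductFDeriv306.fderiv_apply_eq_zero_of_local`);
* §2 `cbInf_comp_ext`, `local_comp_ext`, **`dset_obs_apply`** (assignment form: `∂_{u_D} obs = Σ_{g : D → X} Π_i ∂_{u_{g⁻¹ i}}[f(□_i) ∘ ext]`);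
* §3 **`dset_obs_eq_prod`** (the display: coordinate legs, cube-local factors — ONE assignment survives);
* §4 ON THE CELL'S OBJECTS **`dset_obs_fD_uD_eq_prod`**: the same for the located derivative observables `fD (uD …)` of p. 308 (linear,
  cube-local slot fields, `c_b ≠ 0`, cube-local `V_Y ∈ C_b^∞`, `t` on the branch).
HONEST SCOPE.  Identities only (no estimate); legs along general directions (the source end `C_s𝔫ℱ` of a train) reduce to coordinate legs by
p13's `IsSmoothClass.dset_update_sum` and are not expanded here.
-/

namespace Literature.MathematicalPhysics.QuantumFieldTheory.BalabanImbrieJaffe1984to88.BIJ88CubeProductDset306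

open Finset Function
open scoped BigOperators ContDiff
open BIJ88WickSourceSmooth305 (dset dset_empty dset_insert_max)
open BIJ88SmoothClassCalculus306 (IsSmoothClass)
open BIJ88SmoothFactors5133 (CbInf extCLM extCLM_apply)
open BIJ88PolymerRep5134Gauss (obs)
open BIJ88ProductRuleAllOrders306 (isSmoothClass_span_cbInf subset_span_cbInf dset_prod_apply mem_asg)

/-! ## §1 Locality kills every iterated derivative with a leg off the cube -/

section Local

variable {S : Type} [Fintype S] {κ : Type} [LinearOrder κ]

omit [Fintype S] in
/-- `∂_{u_D} 0 = 0`. [cite: BalabanImbrieJaffe1988, §5.13 p.306] -/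
theorem dset_zero_fun (u : κ → S → ℝ) (D : Finset κ) : dset u D (fun _ : S → ℝ => (0 : ℝ)) = fun _ => 0 := by
  induction D using Finset.induction_on_max with
  | empty => rw [dset_empty]
  | insert a s ha ih =>
    rw [dset_insert_max u ha]
    have h : (fun φ : S → ℝ => fderiv ℝ (fun _ : S → ℝ => (0 : ℝ)) φ (u a)) = fun _ => 0 := by
      funext φ; simp
    rw [h, ih]

variable {J : Type} (cub : S → J)

/-- **LOCALITY KILLS ITERATED DERIVATIVES WITH A LEG OFF THE CUBE**: if `G ∈ C_b^∞` sees only the coordinates in the cube `□_i`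
(`cub x = i`) and some leg `j ∈ D` has a direction vanishing on `□_i`, then `∂_{u_D} G ≡ 0` (differentiate along that leg first —
p13's order-independence — and use `BIJ88CubeProductFDeriv306.fderiv_apply_eq_zero_of_local`). [cite: BalabanImbrieJaffe1988, §5.13 p.305–306] -/
theorem dset_eq_zero_of_local {i : J} {G : (S → ℝ) → ℝ} (hG : CbInf G)
    (hloc : ∀ φ ψ : S → ℝ, (∀ x, cub x = i → φ x = ψ x) → G φ = G ψ) (u : κ → S → ℝ) {D : Finset κ} {j : κ} (hj : j ∈ D)
    (hw : ∀ x, cub x = i → u j x = 0) : dset u D G = fun _ => 0 := by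
  rw [← Finset.insert_erase hj, (isSmoothClass_span_cbInf (S := S)).dset_insert u (Finset.notMem_erase j D) (subset_span_cbInf hG)]
  have h0 : (fun φ => fderiv ℝ G φ (u j)) = fun _ => 0 := funext fun φ =>
    BIJ88CubeProductFDeriv306.fderiv_apply_eq_zero_of_local cub (fun _ : J => G) (i := i) hloc
      ((hG.1.differentiable (by simp)) φ) hw
  rw [h0, dset_zero_fun]

end Local

/-! ## §2 The cube product seen through the fields of `X`: assignment form -/

section Obs

variable {α I : Type} [Fintype α] [DecidableEq α] [DecidableEq I] (blk : α → I) (f : I → (α → ℝ) → ℝ) (X : Finset I)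
variable {κ : Type} [LinearOrder κ] [Fintype κ]

omit [DecidableEq α] in
/-- a `C_b^∞` factor read through the extension by zero `ext X` is `C_b^∞` on the fields of `X`. [cite: BalabanImbrieJaffe1988, §5.13 p.306] -/
theorem cbInf_comp_ext {i : I} (hf : CbInf (f i)) :
    CbInf fun ψ : BIJ88PolymerRep5134Gauss.Site blk X → ℝ => f i (BIJ88PolymerRep5134Gauss.ext blk X ψ) := by
  have h := hf.comp_clm (extCLM blk X)
  refine (congrArg CbInf (funext fun ψ => ?_)).mp h
  simp only [extCLM_apply]

omit [Fintype α] [DecidableEq α] in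
/-- a cube-local factor read through `ext X` is local to the sites of its cube. [cite: BalabanImbrieJaffe1988, §5.13 p.304] -/
theorem local_comp_ext {i : I} (hloc : ∀ φ ψ : α → ℝ, (∀ x, blk x = i → φ x = ψ x) → f i φ = f i ψ)
    (φ ψ : BIJ88PolymerRep5134Gauss.Site blk X → ℝ) (h : ∀ x : BIJ88PolymerRep5134Gauss.Site blk X, blk x.1 = i → φ x = ψ x) :
    f i (BIJ88PolymerRep5134Gauss.ext blk X φ) = f i (BIJ88PolymerRep5134Gauss.ext blk X ψ) := by
  refine hloc _ _ fun y hy => ?_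
  simp only [BIJ88PolymerRep5134Gauss.ext]
  split_ifs with hyX
  · exact h ⟨y, hyX⟩ hy
  · rfl

omit [DecidableEq α] in
/-- **assignment form**: `∂_{u_D}[Π_{□_i⊂X} f(□_i)](φ) = Σ_{g : D → X} Π_{i∈X} ∂_{u_{g⁻¹ i}}[f(□_i) ∘ ext](φ)` for `C_b^∞` factors
(`BIJ88ProductRuleAllOrders306.dset_prod_apply` on the fields of `X`). [cite: BalabanImbrieJaffe1988, §5.13 Eq. (5.13.3) p.306] -/
theorem dset_obs_apply (hf : ∀ i ∈ X, CbInf (f i)) (i₀ : I) (u : κ → BIJ88PolymerRep5134Gauss.Site blk X → ℝ) (D : Finset κ)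
    (φ : BIJ88PolymerRep5134Gauss.Site blk X → ℝ) :
    dset u D (obs blk f X) φ =
      ∑ g ∈ Fintype.piFinset (fun j => if j ∈ D then X else {i₀}),
        ∏ i ∈ X, dset u (D.filter fun j => g j = i) (fun ψ => f i (BIJ88PolymerRep5134Gauss.ext blk X ψ)) φ := by
  have hobs : obs blk f X = fun ψ => ∏ i ∈ X, f i (BIJ88PolymerRep5134Gauss.ext blk X ψ) := rfl
  rw [hobs]
  exact dset_prod_apply u X i₀ D (fun i ψ => f i (BIJ88PolymerRep5134Gauss.ext blk X ψ)) (fun i hi => cbInf_comp_ext blk f X (hf i hi)) φ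

/-! ## §3 Coordinate legs and cube-local factors: one assignment survives -/

/-- **AT EVERY ORDER, EACH LEG LANDS ON THE CUBE OF ITS SITE**: for cube-local `C_b^∞` factors and legs `j ∈ D` along the coordinate
directions `e_{q_j}` (`q_j` a site of `X`),
`∂_{q_D}[Π_{□_i⊂X} f(□_i)](φ) = Π_{i∈X} ∂_{q_{D_i}}[f(□_i) ∘ ext](φ)`, `D_i = {j ∈ D : blk q_j = i}` — the all-orders form of
`BIJ88CubeProductFDeriv306.fderiv_obs_single` / `D2_obs` (p. 305: *"Each Φ contracts … to an f(□_i)_s"*; p. 304: *"no overlap of factors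
between different □_i's"*). [cite: BalabanImbrieJaffe1988, §5.13 Eq. (5.13.3) p.306] -/
theorem dset_obs_eq_prod (hf : ∀ i ∈ X, CbInf (f i))
    (hloc : ∀ i ∈ X, ∀ φ ψ : α → ℝ, (∀ x, blk x = i → φ x = ψ x) → f i φ = f i ψ) (i₀ : I)
    (q : κ → BIJ88PolymerRep5134Gauss.Site blk X) (D : Finset κ) (φ : BIJ88PolymerRep5134Gauss.Site blk X → ℝ) :
    dset (fun j => Pi.single (q j) (1 : ℝ)) D (obs blk f X) φ =
      ∏ i ∈ X, dset (fun j => Pi.single (q j) (1 : ℝ)) (D.filter fun j => blk (q j).1 = i)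
        (fun ψ => f i (BIJ88PolymerRep5134Gauss.ext blk X ψ)) φ := by
  rw [dset_obs_apply blk f X hf i₀]
  -- the surviving assignment
  set g₀ : κ → I := fun j => if j ∈ D then blk (q j).1 else i₀ with hg₀
  have hg₀mem : g₀ ∈ Fintype.piFinset (fun j => if j ∈ D then X else {i₀}) := by
    rw [mem_asg]
    refine ⟨fun j hj => ?_, fun j hj => ?_⟩
    · rw [hg₀]; dsimp only; rw [if_pos hj]; exact (q j).2
    · rw [hg₀]; dsimp only; rw [if_neg hj]
  rw [Finset.sum_eq_single_of_mem g₀ hg₀mem]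
  · refine Finset.prod_congr rfl fun i _ => ?_
    rw [Finset.filter_congr fun j hj => show g₀ j = i ↔ blk (q j).1 = i by rw [hg₀]; dsimp only; rw [if_pos hj]]
  · -- every other assignment has a leg off the cube it is assigned to
    intro g hg hne
    obtain ⟨j, hj⟩ : ∃ j, g j ≠ g₀ j := Function.ne_iff.1 hne
    rw [mem_asg] at hg
    have hjD : j ∈ D := by
      by_contra hjD
      apply hj
      rw [hg.2 j hjD, hg₀]; dsimp only; rw [if_neg hjD]
    have hgj : g j ≠ blk (q j).1 := by
      intro h; apply hj; rw [h, hg₀]; dsimp only; rw [if_pos hjD]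
    refine Finset.prod_eq_zero (hg.1 j hjD) ?_
    have hz := dset_eq_zero_of_local (fun x : BIJ88PolymerRep5134Gauss.Site blk X => blk x.1) (i := g j)
      (cbInf_comp_ext blk f X (hf _ (hg.1 j hjD))) (local_comp_ext blk f X (hloc _ (hg.1 j hjD)))
      (fun j => Pi.single (q j) (1 : ℝ)) (D := D.filter fun j' => g j' = g j) (j := j) (by rw [Finset.mem_filter]; exact ⟨hjD, rfl⟩)
      (fun x hx => by
        rw [Pi.single_apply, if_neg]
        rintro rfl
        exact hgj hx.symm)
    rw [hz]

end Obs

/-! ## §4 On the cell's objects: the located derivative observables -/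

section Located

open BIJ88Sect5Statements (CutoffProfile)
open BIJ88Expansion5143Gauss (fD)
open BIJ88SlotMomentsGauss308 (uD)

variable {α I : Type} [Fintype α] [DecidableEq α] [DecidableEq I] (blk : α → I) (X : Finset I)
variable {κ : Type} [LinearOrder κ] [Fintype κ]
variable (χ : CutoffProfile) {ι υ : Type} [DecidableEq ι] [DecidableEq υ] (p : ℝ) {ek t : ℝ} (B : Finset ι)
  {Φ : ι → (α → ℝ) → ℝ} {c : ι → ℝ} (Ys : Finset υ) {V : υ → (α → ℝ) → ℝ} (cube : ↥B ⊕ ↥Ys → I) {L : Type*} (γ : L → ↥B ⊕ ↥Ys)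

/-- **… FOR THE LOCATED DERIVATIVE OBSERVABLES OF p. 308**: with `f(□_i) := fD_K(□_i)` (`BIJ88Expansion5143Gauss.fD` on
`BIJ88SlotMomentsGauss308.uD`: linear slot fields local to the cube of their slot, `c_b ≠ 0`, cube-local `V_Y ∈ C_b^∞`, `t` on the branch),
the iterated coordinate derivative of `Π_{□_i⊂X} fD_K(□_i)` is the product over the cubes of the iterated derivatives along the legs sitting in
each cube — which then split over the located slots by `BIJ88ProductRuleAllOrders306.dset_fD_uD_apply` / `dset_comp_linear`.
[cite: BalabanImbrieJaffe1988, §5.13 Eq. (5.13.3) p.306, (5.14.3) p.308–309] -/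
theorem dset_obs_fD_uD_eq_prod (hek : 0 < ek) (ht : 0 < t) (h1 : t * ek < 1) (hΦ : ∀ b ∈ B, IsLinearMap ℝ (Φ b))
    (hc : ∀ b ∈ B, c b ≠ 0) (hV : ∀ Y ∈ Ys, CbInf (V Y))
    (hΦloc : ∀ (b : ↥B) (φ ψ : α → ℝ), (∀ x, blk x = cube (Sum.inl b) → φ x = ψ x) → Φ b φ = Φ b ψ)
    (hVloc : ∀ (Y : ↥Ys) (φ ψ : α → ℝ), (∀ x, blk x = cube (Sum.inr Y) → φ x = ψ x) → V Y φ = V Y ψ)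
    (K : Finset L) (i₀ : I) (q : κ → BIJ88PolymerRep5134Gauss.Site blk X) (D : Finset κ)
    (φ : BIJ88PolymerRep5134Gauss.Site blk X → ℝ) :
    dset (fun j => Pi.single (q j) (1 : ℝ)) D (obs blk (fD (uD χ p ek B Φ c Ys V t) cube γ K) X) φ =
      ∏ i ∈ X, dset (fun j => Pi.single (q j) (1 : ℝ)) (D.filter fun j => blk (q j).1 = i)
        (fun ψ => fD (uD χ p ek B Φ c Ys V t) cube γ K i (BIJ88PolymerRep5134Gauss.ext blk X ψ)) φ := by
  refine dset_obs_eq_prod blk _ X (fun i _ => BIJ88SlotFactorsSmooth308.cbInf_fD_uD χ p B Ys hek ht h1 hΦ hc hV cube γ K i)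
    (fun i _ => BIJ88Expansion5143Gauss.fD_local blk γ (fun τ m φ ψ h => ?_) K i) i₀ q D φ
  rcases τ with b | Y
  · simp only [uD, BIJ88SlotMoments308.slotFactor, hΦloc b φ ψ h]
  · simp only [uD, BIJ88SlotMoments308.slotFactor, hVloc Y φ ψ h]

end Located

end Literature.MathematicalPhysics.QuantumFieldTheory.BalabanImbrieJaffe1984to88.BIJ88CubeProductDset306
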